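import Literature.Barriers.ABC.BakerMethodBoundsStewartYuProofs

/-!
# The decisive-prime bootstrap, I: real-variable lemmas

Helpers (`--supports`) for the stub `stub_decisivePrimeBootstrap` of the line
`matveev-face-clearing` for the crux
`Summit.ABC.ABC.Theses.RibetTakahashiSplit.FewPrimeValuationProduct` (stmt-ABC-1563): for abc
triples supported on `≤ 4` primes with no power-of-two member, `∏_{p ∣ abc} v_p(abc) ≤ C_ε rad^ε`,
from Matveev + Yu in Pasten's form and the two-logarithm one-prime depth hypothesis. This file holds
the purely real-variable part of the argument, with `Λ = max(log R, 1)`, `R = rad(abc)`: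

* `decisivePrimeBootstrap_polylog_le_rpow` — `Λ^m ≤ D_ε R^ε`;
* `decisivePrimeBootstrap_real` — **the bootstrap algebra** (registered sub-goal of the stub): from
  `y = log c ≤ k + eΛ + ΦΛ⁵`, `k ≤ C_k Λ⁵`, `1 ≤ B ≤ y` and the dichotomy (`e ≤ R^{εη/8}` or
  `e ≤ C₇ R^{εη/8} Λ^{7A} B^{1-η}`) to `k · e · B² ≤ C R^ε` (the case `B^η ≪ R^{εη/8} polylog`
  is extracted by `decisivePrimeBootstrap_le_rpow_of_le_mul_rpow` and
  `decisivePrimeBootstrap_rpow_inv_bookkeeping`);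
* `decisivePrimeBootstrap_log_max_le` — `log max{e, 2 log c} ≤ C_Y Λ` from the a-priori bound
  `log c ≤ κ R^{1/3} (log R)³` (Stewart–Yu, `Literature.Barriers.ABC.BakerShapeBound (1/3) 3`);
* `decisivePrimeBootstrap_theta_zero_le` — Pasten's `Θ` at threshold `0` is `≤ K⁵ Λ⁴` on `≤ 4`
  primes;
* `decisivePrimeBootstrap_two_adic_numerics`, `decisivePrimeBootstrap_depth_numerics` — the
  numerics turning the `2`-adic clause and the depth hypothesis into the inputs of the algebra.

The arithmetic of non-face triples is in `…StubDecisivePrimeBootstrapShape`, the stub itself in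
`…StubDecisivePrimeBootstrap`.
-/

-- `Summit.ABC.ABC` is the mandated summit-side namespace (CONVENTIONS §2); the duplicate is
-- deliberate.
set_option linter.dupNamespace false

namespace Summit.ABC.ABC.Theorems.FewPrimeValuationProduct

open Finset Real
open Literature.NumberTheory.DiophantineGeometry
open Literature.NumberTheory.DiophantineGeometry.Dioph
open Literature.NumberTheory.DiophantineGeometry.Pasten

/-! ## Real-variable lemmas -/

/-- Polylog versus power: for `m : ℕ`, `ε > 0` there is `D ≥ 0` with `max(log R, 1)^m ≤ D · R^ε`
for all `R ≥ 1` (`log R ≤ R^δ/δ`, `δ = min(1, ε/(m+1))`). `[folklore]` -/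
-- adapted from `Summits/ABC/ABC/Cruxes/FewPrimeValuationProduct/Lines/matveev_face_clearing.lean`
theorem decisivePrimeBootstrap_polylog_le_rpow (m : ℕ) {ε : ℝ} (hε : 0 < ε) :
    ∃ D : ℝ, 0 ≤ D ∧ ∀ R : ℝ, 1 ≤ R → (max (Real.log R) 1) ^ m ≤ D * R ^ ε := by
  set δ : ℝ := min 1 (ε / (m + 1)) with hδ
  have hm1 : (0 : ℝ) < m + 1 := by positivity
  have hδpos : 0 < δ := lt_min one_pos (div_pos hε hm1)
  have hδ1 : δ ≤ 1 := min_le_left _ _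
  have hδm : δ * m ≤ ε := by
    calc δ * m ≤ (ε / (m + 1)) * m :=
          mul_le_mul_of_nonneg_right (min_le_right _ _) (Nat.cast_nonneg m)
      _ ≤ (ε / (m + 1)) * (m + 1) :=
          mul_le_mul_of_nonneg_left (by linarith) (div_pos hε hm1).le
      _ = ε := div_mul_cancel₀ ε hm1.ne'
  refine ⟨δ⁻¹ ^ m, pow_nonneg (inv_nonneg.mpr hδpos.le) m, fun R hR => ?_⟩
  have hR0 : 0 ≤ R := zero_le_one.trans hR
  have hRδ : 1 ≤ R ^ δ := Real.one_le_rpow hR hδpos.le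
  have hkey : max (Real.log R) 1 ≤ R ^ δ / δ := by
    apply max_le
    · exact Real.log_le_rpow_div hR0 hδpos
    · rw [le_div_iff₀ hδpos, one_mul]
      exact hδ1.trans hRδ
  have h0 : 0 ≤ max (Real.log R) 1 := zero_le_one.trans (le_max_right _ _)
  calc (max (Real.log R) 1) ^ m ≤ (R ^ δ / δ) ^ m := pow_le_pow_left₀ h0 hkey m
    _ = δ⁻¹ ^ m * (R ^ δ) ^ m := by rw [div_eq_mul_inv, mul_pow, mul_comm]
    _ = δ⁻¹ ^ m * R ^ (δ * m) := by rw [← Real.rpow_natCast (R ^ δ) m, ← Real.rpow_mul hR0]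
    _ ≤ δ⁻¹ ^ m * R ^ ε := by
        apply mul_le_mul_of_nonneg_left _ (pow_nonneg (inv_nonneg.mpr hδpos.le) m)
        exact Real.rpow_le_rpow_of_exponent_le hR hδm

/-- Extraction of the bootstrap: `B ≤ G · B^{1-η}` with `B ≥ 1`, `η > 0` forces
`B ≤ G^{1/η}`. `[folklore]` -/
theorem decisivePrimeBootstrap_le_rpow_of_le_mul_rpow {B G η : ℝ} (hB : 1 ≤ B) (hη : 0 < η)
    (h : B ≤ G * B ^ (1 - η)) : B ≤ G ^ (1 / η) := by
  have hB0 : 0 < B := by linarith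
  have hsplit : B = B ^ η * B ^ (1 - η) := by
    rw [← Real.rpow_add hB0, add_sub_cancel, Real.rpow_one]
  have hpos : 0 < B ^ (1 - η) := Real.rpow_pos_of_pos hB0 _
  have h1 : B ^ η ≤ G := le_of_mul_le_mul_right (by rwa [← hsplit]) hpos
  have h2 : (B ^ η) ^ (1 / η) = B := by
    rw [← Real.rpow_mul hB0.le, mul_one_div_cancel hη.ne', Real.rpow_one]
  calc B = (B ^ η) ^ (1 / η) := h2.symm
    _ ≤ G ^ (1 / η) := Real.rpow_le_rpow (Real.rpow_nonneg hB0.le _) h1 (by positivity)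

/-- Power bookkeeping: `(C · R^{εη/8} · Λ^{N₁})^{1/η} ≤ C^{1/η} · R^{ε/8} · Λ^{N₂}` when `R, Λ ≥ 1`,
`C ≥ 0` and `N₁/η ≤ N₂`. `[folklore]` -/
theorem decisivePrimeBootstrap_rpow_inv_bookkeeping {C R Λ ε η : ℝ} {N₁ N₂ : ℕ} (hC : 0 ≤ C)
    (hR : 1 ≤ R) (hΛ : 1 ≤ Λ) (hη : 0 < η) (hN : (N₁ : ℝ) / η ≤ N₂) :
    (C * R ^ (ε * η / 8) * Λ ^ N₁) ^ (1 / η) ≤ C ^ (1 / η) * R ^ (ε / 8) * Λ ^ N₂ := by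
  have hR0 : 0 ≤ R := zero_le_one.trans hR
  have hΛ0 : 0 ≤ Λ := zero_le_one.trans hΛ
  have hX0 : 0 ≤ R ^ (ε * η / 8) := Real.rpow_nonneg hR0 _
  have hL0 : 0 ≤ Λ ^ N₁ := pow_nonneg hΛ0 _
  rw [Real.mul_rpow (mul_nonneg hC hX0) hL0, Real.mul_rpow hC hX0]
  have h1 : (R ^ (ε * η / 8)) ^ (1 / η) = R ^ (ε / 8) := by
    rw [← Real.rpow_mul hR0]
    congr 1
    field_simp
  have h2 : (Λ ^ N₁) ^ (1 / η) ≤ Λ ^ N₂ := by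
    rw [← Real.rpow_natCast Λ N₁, ← Real.rpow_mul hΛ0, ← Real.rpow_natCast Λ N₂]
    apply Real.rpow_le_rpow_of_exponent_le hΛ
    rw [mul_one_div]
    exact hN
  rw [h1]
  exact mul_le_mul_of_nonneg_left h2 (mul_nonneg (Real.rpow_nonneg hC _) (Real.rpow_nonneg hR0 _))

set_option maxHeartbeats 400000 in
/-- **The bootstrap algebra.** Fix `ε > 0`, `0 < η ≤ 1` and non-negative constants `Ck, Φ, C₇` and
`A : ℕ`. There is `C` such that for all reals `R ≥ 1`, `k ≥ 0`, `e ≥ 0`, `B ≥ 1`, `y` with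
`Λ = max(log R, 1)`, `X = R^{εη/8}` and
`y ≤ k + eΛ + ΦΛ⁵`, `k ≤ Ck Λ⁵`, `B ≤ y`, and (`e ≤ X` or `e ≤ C₇ X Λ^{7A} B^{1-η}`),
one has `k · e · B² ≤ C · R^ε`. `[folklore]` -/
theorem decisivePrimeBootstrap_real :
    ∀ {ε η Ck Φ C₇ : ℝ} {A : ℕ}, 0 < ε → 0 < η → η ≤ 1 → 0 ≤ Ck → 0 ≤ Φ → 0 ≤ C₇ →
    ∃ C : ℝ, ∀ R Λ X k e B y : ℝ, Λ = max (Real.log R) 1 → X = R ^ (ε * η / 8) →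
      1 ≤ R → 0 ≤ k → 0 ≤ e → 1 ≤ B →
      y ≤ k + e * Λ + Φ * Λ ^ 5 → k ≤ Ck * Λ ^ 5 → B ≤ y →
      (e ≤ X ∨ e ≤ C₇ * X * Λ ^ (7 * A) * B ^ (1 - η)) →
      k * e * B ^ 2 ≤ C * R ^ ε := by
  intro ε η Ck Φ C₇ A hε hη hη1 hCk hΦ hC₇
  -- exponents and constants
  set N₁ : ℕ := 7 * A + 5 with hN₁
  set N₂ : ℕ := ⌈(N₁ : ℝ) / η⌉₊ with hN₂
  set N : ℕ := N₁ + 15 + 3 * N₂ with hN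
  obtain ⟨D, hD0, hD⟩ := decisivePrimeBootstrap_polylog_le_rpow N (half_pos hε)
  set C₅ : ℝ := Ck + 1 + Φ with hC₅
  set C₉ : ℝ := Ck + C₇ + Φ with hC₉
  set C₁₀ : ℝ := C₉ ^ (1 / η) with hC₁₀
  set M : ℝ := Ck * C₅ ^ 2 + Ck * C₇ * C₁₀ ^ 3 with hM
  have hC₅0 : 0 ≤ C₅ := by rw [hC₅]; positivity
  have hC₉0 : 0 ≤ C₉ := by rw [hC₉]; positivity
  have hC₁₀0 : 0 ≤ C₁₀ := Real.rpow_nonneg hC₉0 _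
  have hM0 : 0 ≤ M := by rw [hM]; positivity
  have hN₂ : (N₁ : ℝ) / η ≤ N₂ := Nat.le_ceil _
  refine ⟨M * D, ?_⟩
  intro R Λ X k e B y hΛ hX hR hk he hB hy hkb hBy hcase
  -- basic facts
  have hR0 : 0 < R := by linarith
  have hΛ1 : 1 ≤ Λ := by rw [hΛ]; exact le_max_right _ _
  have hΛ0 : 0 ≤ Λ := zero_le_one.trans hΛ1
  have hX1 : 1 ≤ X := by rw [hX]; exact Real.one_le_rpow hR (by positivity)
  have hX0 : 0 ≤ X := zero_le_one.trans hX1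
  have hB0 : 0 ≤ B := zero_le_one.trans hB
  have hεη : ε * η ≤ ε := by nlinarith
  have hpoly : Λ ^ N ≤ D * R ^ (ε / 2) := by rw [hΛ]; exact hD R hR
  have hRε2 : 0 ≤ R ^ (ε / 2) := Real.rpow_nonneg hR0.le _
  have hΛpow : ∀ {m n : ℕ}, m ≤ n → Λ ^ m ≤ Λ ^ n := fun hmn => pow_le_pow_right₀ hΛ1 hmn
  -- it suffices to bound by `M · R^{ε/2} · Λ^N`
  suffices hmain : k * e * B ^ 2 ≤ M * R ^ (ε / 2) * Λ ^ N by
    calc k * e * B ^ 2 ≤ M * R ^ (ε / 2) * Λ ^ N := hmain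
      _ ≤ M * R ^ (ε / 2) * (D * R ^ (ε / 2)) :=
          mul_le_mul_of_nonneg_left hpoly (mul_nonneg hM0 hRε2)
      _ = M * D * (R ^ (ε / 2) * R ^ (ε / 2)) := by ring
      _ = M * D * R ^ ε := by rw [← Real.rpow_add hR0]; ring_nf
  rcases hcase with h1 | h2
  · -- Case 1: `e ≤ X`
    have hX3 : X * X ^ 2 ≤ R ^ (ε / 2) := by
      rw [hX, ← pow_succ', ← Real.rpow_natCast, ← Real.rpow_mul hR0.le]
      apply Real.rpow_le_rpow_of_exponent_le hR
      push_cast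
      nlinarith
    have hy' : y ≤ C₅ * X * Λ ^ 5 := by
      have h15 : Λ ≤ Λ ^ 5 := by
        calc Λ = Λ ^ 1 := (pow_one Λ).symm
          _ ≤ Λ ^ 5 := hΛpow (by norm_num)
      have hΛ5 : 0 ≤ Λ ^ 5 := pow_nonneg hΛ0 5
      have t1 : Ck * Λ ^ 5 ≤ Ck * X * Λ ^ 5 := by
        rw [mul_assoc]
        exact mul_le_mul_of_nonneg_left (le_mul_of_one_le_left hΛ5 hX1) hCk
      have t2 : e * Λ ≤ X * Λ ^ 5 := mul_le_mul h1 h15 hΛ0 hX0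
      have t3 : Φ * Λ ^ 5 ≤ Φ * X * Λ ^ 5 := by
        rw [mul_assoc]
        exact mul_le_mul_of_nonneg_left (le_mul_of_one_le_left hΛ5 hX1) hΦ
      calc y ≤ k + e * Λ + Φ * Λ ^ 5 := hy
        _ ≤ Ck * X * Λ ^ 5 + X * Λ ^ 5 + Φ * X * Λ ^ 5 := by linarith
        _ = C₅ * X * Λ ^ 5 := by rw [hC₅]; ring
    have hB' : B ≤ C₅ * X * Λ ^ 5 := hBy.trans hy'
    have hW0 : 0 ≤ C₅ * X * Λ ^ 5 := by positivity
    calc k * e * B ^ 2 ≤ Ck * Λ ^ 5 * X * (C₅ * X * Λ ^ 5) ^ 2 := by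
          apply mul_le_mul (mul_le_mul hkb h1 he (by positivity)) (pow_le_pow_left₀ hB0 hB' 2)
            (by positivity) (by positivity)
      _ = Ck * C₅ ^ 2 * (X * X ^ 2) * Λ ^ 15 := by ring
      _ ≤ Ck * C₅ ^ 2 * R ^ (ε / 2) * Λ ^ N := by
          apply mul_le_mul (mul_le_mul_of_nonneg_left hX3 (by positivity)) (hΛpow (by omega))
            (by positivity) (by positivity)
      _ ≤ M * R ^ (ε / 2) * Λ ^ N := by
          apply mul_le_mul_of_nonneg_right _ (pow_nonneg hΛ0 N)
          apply mul_le_mul_of_nonneg_right _ hRε2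
          rw [hM]
          have : 0 ≤ Ck * C₇ * C₁₀ ^ 3 := by positivity
          linarith
  · -- Case 2: `e ≤ C₇ X Λ^{7A} B^{1-η}`
    have hBη1 : 1 ≤ B ^ (1 - η) := Real.one_le_rpow hB (by linarith)
    have hBη0 : 0 ≤ B ^ (1 - η) := zero_le_one.trans hBη1
    have hBηB : B ^ (1 - η) ≤ B := by
      calc B ^ (1 - η) ≤ B ^ (1 : ℝ) := Real.rpow_le_rpow_of_exponent_le hB (by linarith)
        _ = B := Real.rpow_one B
    -- `W = X Λ^{N₁} B^{1-η}` dominates `Λ⁵` and `X Λ^{7A+1} B^{1-η}`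
    set W : ℝ := X * Λ ^ N₁ * B ^ (1 - η) with hW
    have hW0 : 0 ≤ W := by positivity
    have hΛW : Λ ^ 5 ≤ W := by
      calc Λ ^ 5 ≤ Λ ^ N₁ := hΛpow (by omega)
        _ = 1 * Λ ^ N₁ * 1 := by ring
        _ ≤ X * Λ ^ N₁ * B ^ (1 - η) :=
            mul_le_mul (mul_le_mul_of_nonneg_right hX1 (pow_nonneg hΛ0 _)) hBη1 zero_le_one
              (by positivity)
    have heW : e * Λ ≤ C₇ * W := by
      calc e * Λ ≤ C₇ * X * Λ ^ (7 * A) * B ^ (1 - η) * Λ := mul_le_mul_of_nonneg_right h2 hΛ0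
        _ = C₇ * (X * Λ ^ (7 * A + 1) * B ^ (1 - η)) := by ring
        _ ≤ C₇ * W := by
            apply mul_le_mul_of_nonneg_left _ hC₇
            apply mul_le_mul_of_nonneg_right _ hBη0
            exact mul_le_mul_of_nonneg_left (hΛpow (by omega)) hX0
    have hy' : y ≤ C₉ * W := by
      calc y ≤ k + e * Λ + Φ * Λ ^ 5 := hy
        _ ≤ Ck * W + C₇ * W + Φ * W := by
            have t1 : Ck * Λ ^ 5 ≤ Ck * W := mul_le_mul_of_nonneg_left hΛW hCk
            have t3 : Φ * Λ ^ 5 ≤ Φ * W := mul_le_mul_of_nonneg_left hΛW hΦ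
            linarith
        _ = C₉ * W := by rw [hC₉]; ring
    -- the extraction: `B ≤ (C₉ X Λ^{N₁})^{1/η} ≤ C₁₀ R^{ε/8} Λ^{N₂}`
    have hBW : B ≤ C₉ * X * Λ ^ N₁ * B ^ (1 - η) := by
      calc B ≤ y := hBy
        _ ≤ C₉ * W := hy'
        _ = C₉ * X * Λ ^ N₁ * B ^ (1 - η) := by rw [hW]; ring
    have hB1 : B ≤ (C₉ * X * Λ ^ N₁) ^ (1 / η) :=
      decisivePrimeBootstrap_le_rpow_of_le_mul_rpow hB hη hBW
    have hB2 : B ≤ C₁₀ * R ^ (ε / 8) * Λ ^ N₂ := by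
      refine hB1.trans ?_
      rw [hX, hC₁₀]
      exact decisivePrimeBootstrap_rpow_inv_bookkeeping hC₉0 hR hΛ1 hη hN₂
    have hV0 : 0 ≤ C₁₀ * R ^ (ε / 8) * Λ ^ N₂ := by positivity
    have he' : e ≤ C₇ * X * Λ ^ (7 * A) * B :=
      h2.trans (mul_le_mul_of_nonneg_left hBηB (by positivity))
    have hXR : X * (R ^ (ε / 8)) ^ 3 ≤ R ^ (ε / 2) := by
      rw [hX, ← Real.rpow_natCast, ← Real.rpow_mul hR0.le, ← Real.rpow_add hR0]
      apply Real.rpow_le_rpow_of_exponent_le hR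
      push_cast
      nlinarith
    calc k * e * B ^ 2 ≤ Ck * Λ ^ 5 * (C₇ * X * Λ ^ (7 * A) * B) * B ^ 2 :=
          mul_le_mul_of_nonneg_right (mul_le_mul hkb he' he (by positivity)) (by positivity)
      _ = Ck * C₇ * X * Λ ^ (7 * A + 5) * B ^ 3 := by ring
      _ ≤ Ck * C₇ * X * Λ ^ (7 * A + 5) * (C₁₀ * R ^ (ε / 8) * Λ ^ N₂) ^ 3 :=
          mul_le_mul_of_nonneg_left (pow_le_pow_left₀ hB0 hB2 3) (by positivity)
      _ = Ck * C₇ * C₁₀ ^ 3 * (X * (R ^ (ε / 8)) ^ 3) * Λ ^ (7 * A + 5 + 3 * N₂) := by ring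
      _ ≤ Ck * C₇ * C₁₀ ^ 3 * R ^ (ε / 2) * Λ ^ N := by
          apply mul_le_mul (mul_le_mul_of_nonneg_left hXR (by positivity)) (hΛpow (by omega))
            (by positivity) (by positivity)
      _ ≤ M * R ^ (ε / 2) * Λ ^ N := by
          apply mul_le_mul_of_nonneg_right _ (pow_nonneg hΛ0 N)
          apply mul_le_mul_of_nonneg_right _ hRε2
          rw [hM]
          have : 0 ≤ Ck * C₅ ^ 2 := by positivity
          linarith

/-- `Y = log max{e, 2 log c} ≤ C_Y · max(log R, 1)` from the a-priori size bound
`log c ≤ κ R^{1/3} (log R)³` (`R ≥ 1`), with `C_Y = 5 + log(2 max(κ, 1))`. `[folklore]` -/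
theorem decisivePrimeBootstrap_log_max_le {κ R y : ℝ} (hR : 1 ≤ R)
    (hy : y ≤ κ * R ^ (1 / 3 : ℝ) * Real.log R ^ 3) :
    Real.log (max (Real.exp 1) (2 * y)) ≤ (5 + Real.log (2 * max κ 1)) * max (Real.log R) 1 := by
  set κ' : ℝ := max κ 1 with hκ'
  set Λ : ℝ := max (Real.log R) 1 with hΛ
  have hκ'1 : 1 ≤ κ' := le_max_right _ _
  have hΛ1 : 1 ≤ Λ := le_max_right _ _
  have hR0 : 0 < R := by linarith
  have hlog0 : 0 ≤ Real.log R := Real.log_nonneg hR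
  have hlogΛ : Real.log R ≤ Λ := le_max_left _ _
  have hR13 : R ^ (1 / 3 : ℝ) ≤ R := by
    calc R ^ (1 / 3 : ℝ) ≤ R ^ (1 : ℝ) := Real.rpow_le_rpow_of_exponent_le hR (by norm_num)
      _ = R := Real.rpow_one R
  have hlog3 : Real.log R ^ 3 ≤ R ^ 3 := pow_le_pow_left₀ hlog0 (Real.log_le_self hR0.le) 3
  have hy' : y ≤ κ' * R ^ 4 := by
    calc y ≤ κ * R ^ (1 / 3 : ℝ) * Real.log R ^ 3 := hy
      _ ≤ κ' * R ^ (1 / 3 : ℝ) * Real.log R ^ 3 := by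
          apply mul_le_mul_of_nonneg_right _ (pow_nonneg hlog0 3)
          exact mul_le_mul_of_nonneg_right (le_max_left _ _) (Real.rpow_nonneg hR0.le _)
      _ ≤ κ' * R * R ^ 3 := by
          apply mul_le_mul (mul_le_mul_of_nonneg_left hR13 (by linarith)) hlog3 (pow_nonneg hlog0 3)
          exact mul_nonneg (by linarith) hR0.le
      _ = κ' * R ^ 4 := by ring
  have hR4 : 1 ≤ R ^ 4 := one_le_pow₀ hR
  have hM1 : 1 ≤ 2 * κ' * R ^ 4 := by nlinarith
  have he1 : 1 ≤ Real.exp 1 := by have := Real.add_one_le_exp (1 : ℝ); linarith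
  have hmax : max (Real.exp 1) (2 * y) ≤ Real.exp 1 * (2 * κ' * R ^ 4) := by
    apply max_le
    · exact le_mul_of_one_le_right (Real.exp_pos 1).le hM1
    · calc 2 * y ≤ 2 * κ' * R ^ 4 := by linarith
        _ ≤ Real.exp 1 * (2 * κ' * R ^ 4) := le_mul_of_one_le_left (by linarith) he1
  have hlog2κ : 0 ≤ Real.log (2 * κ') := Real.log_nonneg (by linarith)
  calc Real.log (max (Real.exp 1) (2 * y)) ≤ Real.log (Real.exp 1 * (2 * κ' * R ^ 4)) :=
        Real.log_le_log (lt_max_of_lt_left (Real.exp_pos 1)) hmax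
    _ = 1 + Real.log (2 * κ') + 4 * Real.log R := by
        rw [Real.log_mul (Real.exp_pos 1).ne' (by positivity), Real.log_exp,
          show 2 * κ' * R ^ 4 = (2 * κ') * R ^ 4 by ring,
          Real.log_mul (by positivity) (by positivity), Real.log_pow]
        push_cast
        ring
    _ ≤ 1 * Λ + Real.log (2 * κ') * Λ + 4 * Λ := by
        have : Real.log (2 * κ') ≤ Real.log (2 * κ') * Λ := le_mul_of_one_le_right hlog2κ hΛ1
        linarith
    _ = (5 + Real.log (2 * κ')) * Λ := by ring

/-- Pasten's `Θ` at threshold `0` for a coprime pair supported on `≤ 4` primes of size `≤ e^Λ`: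
`theta K u v 0 ≤ K⁵ Λ⁴`. `[folklore]` -/
theorem decisivePrimeBootstrap_theta_zero_le {K Λ : ℝ} (hK : 1 ≤ K) (hΛ : 1 ≤ Λ) {u v : ℕ}
    (hu : u ≠ 0) (hv : v ≠ 0) (huv : u.Coprime v) (hcard : (u * v).primeFactors.card ≤ 4)
    (hlog : ∀ p ∈ (u * v).primeFactors, Real.log p ≤ Λ) : theta K u v 0 ≤ K ^ 5 * Λ ^ 4 := by
  rw [Literature.Barriers.ABC.theta_zero_eq K hu hv huv]
  have h1 : K ^ ((u * v).primeFactors.card + 1) ≤ K ^ 5 := pow_le_pow_right₀ hK (by omega)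
  have hlog0 : ∀ p ∈ (u * v).primeFactors, 0 ≤ Real.log p := fun p hp =>
    Real.log_nonneg (by exact_mod_cast (Nat.prime_of_mem_primeFactors hp).one_lt.le)
  have h2 : ∏ p ∈ (u * v).primeFactors, Real.log p ≤ Λ ^ 4 := by
    calc ∏ p ∈ (u * v).primeFactors, Real.log p ≤ ∏ _p ∈ (u * v).primeFactors, Λ :=
          Finset.prod_le_prod hlog0 hlog
      _ = Λ ^ (u * v).primeFactors.card := Finset.prod_const Λ
      _ ≤ Λ ^ 4 := pow_le_pow_right₀ hΛ hcard
  exact mul_le_mul h1 h2 (Finset.prod_nonneg hlog0) (by positivity)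

/-- Numerics of the `2`-adic clause: from `n · log 2 < Θ · (2/log 2)(log 2 + Y)` with
`0 ≤ Θ ≤ T Λ⁴`, `1 ≤ Y ≤ C_Y Λ`, `n ≥ 0`: `n ≤ 9 T C_Y Λ⁵`. `[folklore]` -/
theorem decisivePrimeBootstrap_two_adic_numerics {Θ T Y CY Λ n : ℝ} (hΘ0 : 0 ≤ Θ)
    (hΘ : Θ ≤ T * Λ ^ 4) (hY1 : 1 ≤ Y) (hY : Y ≤ CY * Λ) (hn : 0 ≤ n)
    (h : n * Real.log 2 < Θ * ((2 / Real.log 2) * (Real.log 2 + Y))) :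
    n ≤ 9 * T * CY * Λ ^ 5 := by
  have hl2 : (0.6931471803 : ℝ) < Real.log 2 := Real.log_two_gt_d9
  have hl2' : Real.log 2 < 0.6931471808 := Real.log_two_lt_d9
  have hl2pos : 0 < Real.log 2 := by linarith
  have h1 : Real.log 2 + Y ≤ 2 * Y := by linarith
  have h2 : Θ * ((2 / Real.log 2) * (Real.log 2 + Y)) * Real.log 2 = 2 * Θ * (Real.log 2 + Y) := by
    field_simp
  have h3 : n * Real.log 2 * Real.log 2 < 2 * Θ * (Real.log 2 + Y) := by
    rw [← h2]; exact mul_lt_mul_of_pos_right h hl2pos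
  have hTΛ : 0 ≤ T * Λ ^ 4 := hΘ0.trans hΘ
  have h4 : 2 * Θ * (Real.log 2 + Y) ≤ 2 * (T * Λ ^ 4) * (2 * (CY * Λ)) :=
    mul_le_mul (mul_le_mul_of_nonneg_left hΘ two_pos.le) (h1.trans (by linarith)) (by linarith)
      (by positivity)
  have h5 : n * Real.log 2 ^ 2 < 4 * T * CY * Λ ^ 5 := by
    calc n * Real.log 2 ^ 2 = n * Real.log 2 * Real.log 2 := by ring
      _ < 2 * Θ * (Real.log 2 + Y) := h3
      _ ≤ 2 * (T * Λ ^ 4) * (2 * (CY * Λ)) := h4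
      _ = 4 * T * CY * Λ ^ 5 := by ring
  have hsq : 4 / 9 ≤ Real.log 2 ^ 2 := by nlinarith
  have h6 : n * (4 / 9) ≤ n * Real.log 2 ^ 2 := mul_le_mul_of_nonneg_left hsq hn
  linarith

/-- From the two-logarithm bound to the shape used by the bootstrap algebra:
`e ≤ C_T ℓ^{ε'} (L (j+1))^A B_η` with `ℓ^{ε'} ≤ R^{ε'}`, `0 ≤ L ≤ Λ²`, `0 ≤ j ≤ k ≤ C_k Λ⁵`,
`0 ≤ B_η ≤ B_{η₀}` gives `e ≤ max(C_T,1) (C_k+1)^A · R^{ε'} · Λ^{7A} · B_{η₀}`. `[folklore]` -/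
theorem decisivePrimeBootstrap_depth_numerics {e CT ℓε Rε L Λ Ck kk jj Bη Bη₀ : ℝ} {A : ℕ}
    (h : e ≤ CT * ℓε * (L * (jj + 1)) ^ A * Bη) (hℓR : ℓε ≤ Rε) (hℓ0 : 0 ≤ ℓε) (hL0 : 0 ≤ L)
    (hL : L ≤ Λ ^ 2) (hjj0 : 0 ≤ jj) (hjk : jj ≤ kk) (hk : kk ≤ Ck * Λ ^ 5) (hCk : 0 ≤ Ck)
    (hΛ : 1 ≤ Λ) (hBη0 : 0 ≤ Bη) (hB : Bη ≤ Bη₀) :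
    e ≤ max CT 1 * (Ck + 1) ^ A * Rε * Λ ^ (7 * A) * Bη₀ := by
  have hΛ0 : 0 ≤ Λ := zero_le_one.trans hΛ
  have hCT : CT ≤ max CT 1 := le_max_left _ _
  have hCT0 : 0 ≤ max CT 1 := zero_le_one.trans (le_max_right _ _)
  have hLj0 : 0 ≤ L * (jj + 1) := by positivity
  have hΛ5 : 1 ≤ Λ ^ 5 := one_le_pow₀ hΛ
  have hLj : L * (jj + 1) ≤ (Ck + 1) * Λ ^ 7 := by
    calc L * (jj + 1) ≤ Λ ^ 2 * (Ck * Λ ^ 5 + Λ ^ 5) :=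
          mul_le_mul hL (by linarith) (by positivity) (by positivity)
      _ = (Ck + 1) * Λ ^ 7 := by ring
  have hpow : (L * (jj + 1)) ^ A ≤ (Ck + 1) ^ A * Λ ^ (7 * A) := by
    calc (L * (jj + 1)) ^ A ≤ ((Ck + 1) * Λ ^ 7) ^ A := pow_le_pow_left₀ hLj0 hLj A
      _ = (Ck + 1) ^ A * Λ ^ (7 * A) := by rw [mul_pow, ← pow_mul]
  have hpow0 : 0 ≤ (L * (jj + 1)) ^ A := pow_nonneg hLj0 A
  calc e ≤ CT * ℓε * (L * (jj + 1)) ^ A * Bη := h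
    _ ≤ max CT 1 * ℓε * (L * (jj + 1)) ^ A * Bη := by
        apply mul_le_mul_of_nonneg_right _ hBη0
        apply mul_le_mul_of_nonneg_right _ hpow0
        exact mul_le_mul_of_nonneg_right hCT hℓ0
    _ ≤ max CT 1 * Rε * ((Ck + 1) ^ A * Λ ^ (7 * A)) * Bη₀ := by
        have hRε0 : 0 ≤ Rε := hℓ0.trans hℓR
        apply mul_le_mul _ hB hBη0 (mul_nonneg (mul_nonneg hCT0 hRε0) (by positivity))
        apply mul_le_mul _ hpow hpow0 (mul_nonneg hCT0 hRε0)
        exact mul_le_mul_of_nonneg_left hℓR hCT0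
    _ = max CT 1 * (Ck + 1) ^ A * Rε * Λ ^ (7 * A) * Bη₀ := by ring

end Summit.ABC.ABC.Theorems.FewPrimeValuationProduct
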